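import Mathlib
import HarnessLib

/-!
# Volterra integral equation for the recessive solution `u ~ z^{-n}` of `u'' = (n(n+1)/z² + q) u`

Analysis/ODE support file (everything proved, no definitions). For a continuous short-range `q`
(`s ↦ s|q s|` integrable on `(A,∞)`, `A ≥ 1`) the substitution `f = zⁿu` turns
`u = z⁻ⁿ − ∫_z^∞ K₀(z,s) q u ds`, `K₀ = (zⁿ⁺¹s⁻ⁿ − z⁻ⁿsⁿ⁺¹)/(2n+1)`, into
`f(z) = 1 − (z^{2n+1}∫_z^∞ s^{−2n} q f − ∫_z^∞ s q f)/(2n+1)`. This file proves the tail estimates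
(`inverseSquare_tail_estimate`, `…₁`: both pieces are `≤ C∫_z^∞ s|q|` for `|f| ≤ C`), the
differentiability of tails (`hasDerivAt_setIntegral_Ioi_tail`), and the existence of the fixed point
when `∫_A^∞ s|q| ≤ ¼` (`exists_inverseSquare_volterra`: continuous `f`, `|f| ≤ 2`,
`|f − 1| ≤ 4∫ s|q|`; a `2Q`-contraction on bounded continuous functions, frozen below `A`).
The solution itself is assembled in `InverseSquareRecessive.lean`. Classical (Jost / Levinson;
Hartman, *ODE*, Ch. XI §9). Route PhotonSphereChannels, `FixedModeChannels`, far side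
(stmt-FinalStateConjecture-10048).
-/

noncomputable section

namespace Literature.Analysis.ODE

open MeasureTheory Set Filter Topology intervalIntegral BoundedContinuousFunction

variable {P q : ℝ → ℝ} {A : ℝ} {n : ℕ}

/-- Tail integrals over `Ioi b` of a function integrable on `Ioi A` are continuous in `b`
and differentiable at interior points with derivative `−k b`. [folklore] -/
theorem hasDerivAt_setIntegral_Ioi_tail {k : ℝ → ℝ} (hk : Continuous k)
    (hki : IntegrableOn k (Ioi A)) {b : ℝ} (hb : A < b) :
    HasDerivAt (fun b => ∫ s in Ioi b, k s) (-k b) b := by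
  have heq : (fun b => ∫ s in Ioi b, k s)
      =ᶠ[𝓝 b] fun b => (∫ s in Ioi A, k s) - ∫ s in A..b, k s := by
    filter_upwards [Ioi_mem_nhds hb] with c hc
    have hc' : A ≤ c := le_of_lt hc
    rw [← Ioc_union_Ioi_eq_Ioi hc', setIntegral_union (Ioc_disjoint_Ioi le_rfl) measurableSet_Ioi
      (hki.mono_set Ioc_subset_Ioi_self) (hki.mono_set (Ioi_subset_Ioi hc')),
      intervalIntegral.integral_of_le hc']
    ring
  refine HasDerivAt.congr_of_eventuallyEq ?_ heq
  have h := (intervalIntegral.integral_hasDerivAt_right (hk.intervalIntegrable A b)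
    (hk.stronglyMeasurableAtFilter _ _) hk.continuousAt).const_sub (∫ s in Ioi A, k s)
  simpa using h

section
variable (hq : Continuous q) (hA : 1 ≤ A) (hqi : IntegrableOn (fun s => s * |q s|) (Ioi A))
include hq hA hqi

/-- Integrability of the two Volterra weights `(max s 1)^{-2n} q` and `s q` against bounded
continuous functions on `Ioi b`, `b ≥ A`. [folklore] -/
theorem inverseSquare_weights_integrable {φ : ℝ → ℝ} (hφ : Continuous φ) {C : ℝ}
    (hC : ∀ y, |φ y| ≤ C) {b : ℝ} (hb : A ≤ b) (n : ℕ) :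
    IntegrableOn (fun s => ((max s 1) ^ (2 * n))⁻¹ * q s * φ s) (Ioi b) ∧
      IntegrableOn (fun s => s * q s * φ s) (Ioi b) := by
  have hw₁c : Continuous (fun s : ℝ => ((max s 1) ^ (2 * n))⁻¹ * q s) := by
    refine (Continuous.inv₀ ((continuous_id.max continuous_const).pow _) fun s => ?_).mul hq
    exact pow_ne_zero _ (by positivity)
  have hw₁i : IntegrableOn (fun s : ℝ => ((max s 1) ^ (2 * n))⁻¹ * q s) (Ioi A) := by
    refine Integrable.mono' hqi hw₁c.aestronglyMeasurable ?_
    refine (ae_restrict_iff' measurableSet_Ioi).2 (ae_of_all _ fun s hs => ?_)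
    have hs' := Set.mem_Ioi.1 hs
    have hs1 : 1 ≤ s := hA.trans hs'.le
    rw [Real.norm_eq_abs, abs_mul, abs_inv, abs_pow, max_eq_left hs1,
      abs_of_pos (by linarith : (0:ℝ) < s)]
    refine mul_le_mul_of_nonneg_right ?_ (abs_nonneg _)
    exact (inv_le_one_of_one_le₀ (one_le_pow₀ hs1)).trans hs1
  have hw₂i : IntegrableOn (fun s : ℝ => s * q s) (Ioi A) := by
    refine Integrable.mono' hqi (continuous_id.mul hq).aestronglyMeasurable ?_
    refine (ae_restrict_iff' measurableSet_Ioi).2 (ae_of_all _ fun s hs => ?_)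
    have hs' := Set.mem_Ioi.1 hs
    rw [Real.norm_eq_abs, abs_mul, abs_of_pos (by linarith : (0:ℝ) < s)]
  have hbdd : ∀ {k : ℝ → ℝ}, IntegrableOn k (Ioi A) →
      IntegrableOn (fun y => k y * φ y) (Ioi b) := by
    intro k hk
    have : (fun y => k y * φ y) = fun y => φ y * k y := by funext y; ring
    rw [this]
    exact Integrable.bdd_mul (hk.mono_set (Ioi_subset_Ioi hb)) hφ.aestronglyMeasurable
      (Eventually.of_forall fun y => by rw [Real.norm_eq_abs]; exact hC y)
  exact ⟨hbdd hw₁i, hbdd hw₂i⟩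

/-- **The basic tail estimate** of the Volterra operator:
`|b^{2n+1} ∫_b^∞ s^{−2n} q φ − ∫_b^∞ s q φ| ≤ 2C ∫_b^∞ s|q|` for `|φ| ≤ C`, `b ≥ A`. [folklore] -/
theorem inverseSquare_tail_estimate {φ : ℝ → ℝ} (hφ : Continuous φ) {C : ℝ}
    (hC : ∀ y, |φ y| ≤ C) {b : ℝ} (hb : A ≤ b) (n : ℕ) :
    |b ^ (2 * n + 1) * (∫ s in Ioi b, ((max s 1) ^ (2 * n))⁻¹ * q s * φ s)
        - ∫ s in Ioi b, s * q s * φ s|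
      ≤ 2 * C * ∫ s in Ioi b, s * |q s| := by
  have hC0 : 0 ≤ C := (abs_nonneg _).trans (hC 0)
  have hb0 : 0 < b := by linarith
  have hqb : IntegrableOn (fun s => s * |q s|) (Ioi b) := hqi.mono_set (Ioi_subset_Ioi hb)
  obtain ⟨i1, i2⟩ := inverseSquare_weights_integrable hq hA hqi hφ hC hb n
  have e1 : |b ^ (2 * n + 1) * ∫ s in Ioi b, ((max s 1) ^ (2 * n))⁻¹ * q s * φ s|
      ≤ C * ∫ s in Ioi b, s * |q s| := by
    rw [← MeasureTheory.integral_const_mul]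
    calc |∫ s in Ioi b, b ^ (2 * n + 1) * (((max s 1) ^ (2 * n))⁻¹ * q s * φ s)|
        ≤ ∫ s in Ioi b, |b ^ (2 * n + 1) * (((max s 1) ^ (2 * n))⁻¹ * q s * φ s)| :=
          abs_integral_le_integral_abs
      _ ≤ ∫ s in Ioi b, C * (s * |q s|) := by
          refine setIntegral_mono_on (i1.const_mul _).abs (hqb.const_mul C) measurableSet_Ioi
            fun s hs => ?_
          have hs' : b < s := Set.mem_Ioi.1 hs
          have hs0 : 0 < s := by linarith
          have hs1 : 1 ≤ s := by linarith
          simp only [abs_mul, abs_inv, abs_pow, max_eq_left hs1, abs_of_pos hs0, abs_of_pos hb0]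
          have hpow : b ^ (2 * n + 1) * (s ^ (2 * n))⁻¹ ≤ s := by
            rw [← div_eq_mul_inv, div_le_iff₀ (by positivity), pow_succ]
            calc b ^ (2 * n) * b ≤ s ^ (2 * n) * s :=
                  mul_le_mul (pow_le_pow_left₀ hb0.le hs'.le _) hs'.le hb0.le (by positivity)
              _ = s * s ^ (2 * n) := by ring
          calc b ^ (2 * n + 1) * ((s ^ (2 * n))⁻¹ * |q s| * |φ s|)
              = (b ^ (2 * n + 1) * (s ^ (2 * n))⁻¹) * |q s| * |φ s| := by ring
            _ ≤ s * |q s| * C :=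
                mul_le_mul (mul_le_mul_of_nonneg_right hpow (abs_nonneg _)) (hC s)
                  (abs_nonneg _) (by positivity)
            _ = C * (s * |q s|) := by ring
      _ = C * ∫ s in Ioi b, s * |q s| := MeasureTheory.integral_const_mul _ _
  have e2 : |∫ s in Ioi b, s * q s * φ s| ≤ C * ∫ s in Ioi b, s * |q s| := by
    calc |∫ s in Ioi b, s * q s * φ s| ≤ ∫ s in Ioi b, |s * q s * φ s| :=
          abs_integral_le_integral_abs
      _ ≤ ∫ s in Ioi b, C * (s * |q s|) := by
          refine setIntegral_mono_on i2.abs (hqb.const_mul C) measurableSet_Ioi fun s hs => ?_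
          have hs0 : 0 < s := by have := Set.mem_Ioi.1 hs; linarith
          rw [abs_mul, abs_mul, abs_of_pos hs0]
          calc s * |q s| * |φ s| ≤ s * |q s| * C :=
                mul_le_mul_of_nonneg_left (hC s) (by positivity)
            _ = C * (s * |q s|) := by ring
      _ = C * ∫ s in Ioi b, s * |q s| := MeasureTheory.integral_const_mul _ _
  calc |b ^ (2 * n + 1) * (∫ s in Ioi b, ((max s 1) ^ (2 * n))⁻¹ * q s * φ s)
        - ∫ s in Ioi b, s * q s * φ s|
      ≤ |b ^ (2 * n + 1) * ∫ s in Ioi b, ((max s 1) ^ (2 * n))⁻¹ * q s * φ s|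
        + |∫ s in Ioi b, s * q s * φ s| := abs_sub _ _
    _ ≤ C * (∫ s in Ioi b, s * |q s|) + C * ∫ s in Ioi b, s * |q s| := add_le_add e1 e2
    _ = 2 * C * ∫ s in Ioi b, s * |q s| := by ring

/-- **The Volterra fixed point.** With `m = max z A` there is a continuous `f`, `|f| ≤ 2`, with
`f z = 1 − (m^{2n+1} ∫_m^∞ s^{−2n} q f − ∫_m^∞ s q f)/(2n+1)` for all `z` and
`|f z − 1| ≤ 4 ∫_m^∞ s|q|` — provided `∫_A^∞ s|q| ≤ ¼`. [folklore] -/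
theorem exists_inverseSquare_volterra (hQ : ∫ s in Ioi A, s * |q s| ≤ 1 / 4) (n : ℕ) :
    ∃ f : ℝ → ℝ, Continuous f ∧ (∀ z, |f z| ≤ 2) ∧
      (∀ z, f z = 1 - ((max z A) ^ (2 * n + 1)
          * (∫ s in Ioi (max z A), ((max s 1) ^ (2 * n))⁻¹ * q s * f s)
          - ∫ s in Ioi (max z A), s * q s * f s) / (2 * n + 1)) ∧
      (∀ z, |f z - 1| ≤ 4 * ∫ s in Ioi (max z A), s * |q s|) := by
  set Q : ℝ := ∫ s in Ioi A, s * |q s| with hQdef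
  have hQ0 : 0 ≤ Q := setIntegral_nonneg measurableSet_Ioi fun s hs => by
    have : (0 : ℝ) ≤ s := by have := Set.mem_Ioi.1 hs; linarith
    positivity
  have hN0 : (0 : ℝ) < 2 * n + 1 := by positivity
  have hN1 : (1 : ℝ) ≤ 2 * n + 1 := by have : (0 : ℝ) ≤ n := n.cast_nonneg; linarith
  set m : ℝ → ℝ := fun z => max z A with hm
  have hm_ge : ∀ z, A ≤ m z := fun z => le_max_right _ _
  have hm_cont : Continuous m := continuous_id.max continuous_const
  have hnn : 0 ≤ᵐ[volume.restrict (Ioi A)] fun s => s * |q s| :=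
    (ae_restrict_iff' measurableSet_Ioi).2 (ae_of_all _ fun s hs => by
      have : (0 : ℝ) ≤ s := by have := Set.mem_Ioi.1 hs; linarith
      show (0 : ℝ) ≤ s * |q s|; positivity)
  have htailQ : ∀ b, A ≤ b → (∫ s in Ioi b, s * |q s|) ≤ Q := fun b hb =>
    setIntegral_mono_set hqi hnn (ae_of_all _ (Ioi_subset_Ioi hb))
  -- the two weights as global continuous functions
  set k₁ : ℝ → ℝ := fun s => ((max s 1) ^ (2 * n))⁻¹ * q s with hk₁
  set k₂ : ℝ → ℝ := fun s => s * q s with hk₂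
  have hk₁c : Continuous k₁ := by
    refine (Continuous.inv₀ ((continuous_id.max continuous_const).pow _) fun s => ?_).mul hq
    exact pow_ne_zero _ (by positivity)
  have hk₂c : Continuous k₂ := continuous_id.mul hq
  obtain ⟨hk₁i, hk₂i⟩ : IntegrableOn k₁ (Ioi A) ∧ IntegrableOn k₂ (Ioi A) := by
    have h := inverseSquare_weights_integrable hq hA hqi (φ := fun _ => (1 : ℝ)) continuous_const
      (C := 1) (fun _ => by simp) le_rfl n
    simpa [hk₁, hk₂] using h
  set Top : (ℝ → ℝ) → ℝ → ℝ := fun f z => 1 - ((m z) ^ (2 * n + 1)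
      * (∫ s in Ioi (m z), k₁ s * f s) - ∫ s in Ioi (m z), k₂ s * f s) / (2 * n + 1) with hTop
  -- continuity of tails in the cut-off
  have hprim : ∀ {k : ℝ → ℝ}, Continuous k → IntegrableOn k (Ioi A) →
      Continuous fun z => ∫ s in Ioi (m z), k s := by
    intro k hk hki
    have heq : (fun z => ∫ s in Ioi (m z), k s)
        = fun z => (∫ s in Ioi A, k s) - ∫ s in A..(m z), k s := by
      funext z
      have hb := hm_ge z
      rw [← Ioc_union_Ioi_eq_Ioi hb, setIntegral_union (Ioc_disjoint_Ioi le_rfl) measurableSet_Ioi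
        (hki.mono_set Ioc_subset_Ioi_self) (hki.mono_set (Ioi_subset_Ioi hb)),
        intervalIntegral.integral_of_le hb]
      ring
    rw [heq]
    exact continuous_const.sub ((intervalIntegral.continuous_primitive (μ := volume)
      (fun a b => hk.intervalIntegrable a b) A).comp hm_cont)
  have hbdd_int : ∀ {φ : ℝ → ℝ}, Continuous φ → ∀ C, (∀ y, |φ y| ≤ C) → ∀ {k : ℝ → ℝ},
      Continuous k → IntegrableOn k (Ioi A) → IntegrableOn (fun y => k y * φ y) (Ioi A) := by
    intro φ hφ C hC k hk hki
    have : (fun y => k y * φ y) = fun y => φ y * k y := by funext y; ring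
    rw [this]
    exact Integrable.bdd_mul hki hφ.aestronglyMeasurable
      (Eventually.of_forall fun y => by rw [Real.norm_eq_abs]; exact hC y)
  have hTop_cont : ∀ {φ : ℝ → ℝ}, Continuous φ → ∀ C, (∀ y, |φ y| ≤ C) → Continuous (Top φ) := by
    intro φ hφ C hC
    simp only [hTop]
    refine continuous_const.sub (((hm_cont.pow _).mul ?_).sub ?_ |>.div_const _)
    · exact hprim (hk₁c.mul hφ) (hbdd_int hφ C hC hk₁c hk₁i)
    · exact hprim (hk₂c.mul hφ) (hbdd_int hφ C hC hk₂c hk₂i)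
  have hTop_bound : ∀ {φ : ℝ → ℝ}, Continuous φ → ∀ C, (∀ y, |φ y| ≤ C) → ∀ z,
      |Top φ z - 1| ≤ 2 * C * Q := by
    intro φ hφ C hC z
    have hC0 : 0 ≤ C := (abs_nonneg _).trans (hC 0)
    have h := inverseSquare_tail_estimate hq hA hqi hφ hC (hm_ge z) n
    simp only [hTop, sub_sub_cancel_left, abs_neg, abs_div, abs_of_pos hN0]
    calc |(m z) ^ (2 * n + 1) * (∫ s in Ioi (m z), k₁ s * φ s) - ∫ s in Ioi (m z), k₂ s * φ s|
          / (2 * n + 1)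
        ≤ |(m z) ^ (2 * n + 1) * (∫ s in Ioi (m z), k₁ s * φ s) - ∫ s in Ioi (m z), k₂ s * φ s|
          / 1 := div_le_div_of_nonneg_left (abs_nonneg _) one_pos hN1
      _ ≤ 2 * C * ∫ s in Ioi (m z), s * |q s| := by rw [div_one]; exact h
      _ ≤ 2 * C * Q := mul_le_mul_of_nonneg_left (htailQ _ (hm_ge z)) (by positivity)
  -- the operator on bounded continuous functions
  have hnorm_abs : ∀ (f : ℝ →ᵇ ℝ) (y : ℝ), |f y| ≤ ‖f‖ := fun f y => by
    rw [← Real.norm_eq_abs]; exact f.norm_coe_le_norm y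
  have hT_bd : ∀ f : ℝ →ᵇ ℝ, ∀ z, ‖Top f z‖ ≤ 1 + 2 * ‖f‖ * Q := fun f z => by
    have h := hTop_bound f.continuous ‖f‖ (hnorm_abs f) z
    rw [Real.norm_eq_abs]
    have : |Top f z| ≤ |Top f z - 1| + |(1 : ℝ)| := by
      have := abs_add_le (Top f z - 1) 1; simpa only [sub_add_cancel] using this
    rw [abs_one] at this
    linarith
  set T : (ℝ →ᵇ ℝ) → (ℝ →ᵇ ℝ) := fun f =>
    BoundedContinuousFunction.ofNormedAddCommGroup (Top f)
      (hTop_cont f.continuous ‖f‖ (hnorm_abs f)) (1 + 2 * ‖f‖ * Q) (hT_bd f) with hT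
  have hT_apply : ∀ (f : ℝ →ᵇ ℝ) (z : ℝ), T f z = Top f z := fun f z => rfl
  have hT_norm : ∀ f : ℝ →ᵇ ℝ, ‖T f‖ ≤ 1 + 2 * ‖f‖ * Q := fun f =>
    BoundedContinuousFunction.norm_ofNormedAddCommGroup_le _ (by positivity) _
  have h2Q0 : 0 ≤ 2 * Q := by positivity
  have h2Q1 : 2 * Q < 1 := by linarith
  have hK : (((2 * Q).toNNReal : NNReal) : ℝ) = 2 * Q := Real.coe_toNNReal _ h2Q0
  have hT_contr : ContractingWith (2 * Q).toNNReal T := by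
    refine ⟨NNReal.coe_lt_coe.1 (by rw [hK, NNReal.coe_one]; exact h2Q1),
      LipschitzWith.of_dist_le_mul fun f g => ?_⟩
    rw [hK, dist_le (mul_nonneg h2Q0 dist_nonneg)]
    intro z
    rw [hT_apply, hT_apply, Real.dist_eq]
    obtain ⟨i1f, i2f⟩ := inverseSquare_weights_integrable hq hA hqi f.continuous (hnorm_abs f)
      (hm_ge z) n
    obtain ⟨i1g, i2g⟩ := inverseSquare_weights_integrable hq hA hqi g.continuous (hnorm_abs g)
      (hm_ge z) n
    have hdiff : Top f z - Top g z = -(((m z) ^ (2 * n + 1)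
        * (∫ s in Ioi (m z), k₁ s * (f s - g s)) - ∫ s in Ioi (m z), k₂ s * (f s - g s))
        / (2 * n + 1)) := by
      simp only [hTop]
      rw [show (fun s => k₁ s * (f s - g s)) = fun s => k₁ s * f s - k₁ s * g s by funext s; ring,
        show (fun s => k₂ s * (f s - g s)) = fun s => k₂ s * f s - k₂ s * g s by funext s; ring,
        integral_sub i1f i1g, integral_sub i2f i2g]
      ring
    rw [hdiff, abs_neg, abs_div, abs_of_pos hN0]
    have hφ : Continuous fun y => f y - g y := f.continuous.sub g.continuous
    have hC : ∀ y, |f y - g y| ≤ dist f g := fun y => by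
      rw [← Real.dist_eq]; exact dist_coe_le_dist y
    have h := inverseSquare_tail_estimate hq hA hqi hφ hC (hm_ge z) n
    calc |(m z) ^ (2 * n + 1) * (∫ s in Ioi (m z), k₁ s * (f s - g s))
          - ∫ s in Ioi (m z), k₂ s * (f s - g s)| / (2 * n + 1)
        ≤ |(m z) ^ (2 * n + 1) * (∫ s in Ioi (m z), k₁ s * (f s - g s))
          - ∫ s in Ioi (m z), k₂ s * (f s - g s)| / 1 :=
          div_le_div_of_nonneg_left (abs_nonneg _) one_pos hN1
      _ ≤ 2 * dist f g * ∫ s in Ioi (m z), s * |q s| := by rw [div_one]; exact h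
      _ ≤ 2 * dist f g * Q := mul_le_mul_of_nonneg_left (htailQ _ (hm_ge z)) (by positivity)
      _ = 2 * Q * dist f g := by ring
  -- the fixed point
  set u₀ : ℝ →ᵇ ℝ := ContractingWith.fixedPoint T hT_contr with hu₀
  have hfix₀ : T u₀ = u₀ := hT_contr.fixedPoint_isFixedPt
  have hfix : ∀ z, u₀ z = Top u₀ z := fun z => by
    have h := congrArg (fun h : ℝ →ᵇ ℝ => h z) hfix₀
    simpa [hT_apply] using h.symm
  have hnorm : ‖u₀‖ ≤ 2 := by
    have h := hT_norm u₀
    rw [hfix₀] at h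
    nlinarith [norm_nonneg u₀]
  have habs : ∀ z, |u₀ z| ≤ 2 := fun z => (hnorm_abs u₀ z).trans hnorm
  refine ⟨fun z => u₀ z, u₀.continuous, habs, fun z => ?_, fun z => ?_⟩
  · have h := hfix z
    simp only [hTop] at h
    exact h
  · have h := inverseSquare_tail_estimate hq hA hqi u₀.continuous habs (hm_ge z) n
    show |u₀ z - 1| ≤ _
    rw [hfix z]
    simp only [hTop, sub_sub_cancel_left, abs_neg, abs_div, abs_of_pos hN0]
    calc |(m z) ^ (2 * n + 1) * (∫ s in Ioi (m z), k₁ s * u₀ s) - ∫ s in Ioi (m z), k₂ s * u₀ s|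
          / (2 * n + 1)
        ≤ |(m z) ^ (2 * n + 1) * (∫ s in Ioi (m z), k₁ s * u₀ s) - ∫ s in Ioi (m z), k₂ s * u₀ s|
          / 1 := div_le_div_of_nonneg_left (abs_nonneg _) one_pos hN1
      _ ≤ 2 * 2 * ∫ s in Ioi (m z), s * |q s| := by rw [div_one]; exact h
      _ = 4 * ∫ s in Ioi (max z A), s * |q s| := by ring

/-- The first weight alone: `|b^{2n+1} ∫_b^∞ s^{−2n} q φ| ≤ C ∫_b^∞ s|q|`. [folklore] -/
theorem inverseSquare_tail_estimate₁ {φ : ℝ → ℝ} (hφ : Continuous φ) {C : ℝ}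
    (hC : ∀ y, |φ y| ≤ C) {b : ℝ} (hb : A ≤ b) (n : ℕ) :
    |b ^ (2 * n + 1) * (∫ s in Ioi b, ((max s 1) ^ (2 * n))⁻¹ * q s * φ s)|
      ≤ C * ∫ s in Ioi b, s * |q s| := by
  have hC0 : 0 ≤ C := (abs_nonneg _).trans (hC 0)
  have hb0 : 0 < b := by linarith
  have hqb : IntegrableOn (fun s => s * |q s|) (Ioi b) := hqi.mono_set (Ioi_subset_Ioi hb)
  obtain ⟨i1, -⟩ := inverseSquare_weights_integrable hq hA hqi hφ hC hb n
  rw [← MeasureTheory.integral_const_mul]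
  calc |∫ s in Ioi b, b ^ (2 * n + 1) * (((max s 1) ^ (2 * n))⁻¹ * q s * φ s)|
      ≤ ∫ s in Ioi b, |b ^ (2 * n + 1) * (((max s 1) ^ (2 * n))⁻¹ * q s * φ s)| :=
        abs_integral_le_integral_abs
    _ ≤ ∫ s in Ioi b, C * (s * |q s|) := by
        refine setIntegral_mono_on (i1.const_mul _).abs (hqb.const_mul C) measurableSet_Ioi
          fun s hs => ?_
        have hs' : b < s := Set.mem_Ioi.1 hs
        have hs0 : 0 < s := by linarith
        have hs1 : 1 ≤ s := by linarith
        simp only [abs_mul, abs_inv, abs_pow, max_eq_left hs1, abs_of_pos hs0, abs_of_pos hb0]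
        have hpow : b ^ (2 * n + 1) * (s ^ (2 * n))⁻¹ ≤ s := by
          rw [← div_eq_mul_inv, div_le_iff₀ (by positivity), pow_succ]
          calc b ^ (2 * n) * b ≤ s ^ (2 * n) * s :=
                mul_le_mul (pow_le_pow_left₀ hb0.le hs'.le _) hs'.le hb0.le (by positivity)
            _ = s * s ^ (2 * n) := by ring
        calc b ^ (2 * n + 1) * ((s ^ (2 * n))⁻¹ * |q s| * |φ s|)
            = (b ^ (2 * n + 1) * (s ^ (2 * n))⁻¹) * |q s| * |φ s| := by ring
          _ ≤ s * |q s| * C :=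
              mul_le_mul (mul_le_mul_of_nonneg_right hpow (abs_nonneg _)) (hC s)
                (abs_nonneg _) (by positivity)
          _ = C * (s * |q s|) := by ring
    _ = C * ∫ s in Ioi b, s * |q s| := MeasureTheory.integral_const_mul _ _

end

end Literature.Analysis.ODE
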